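import Summits.SmoothPoincare4.SmoothPoincare4.Theses.ZeroSurgeryExotic
import Literature.Topology.FourManifolds.ZeroSurgeryHomotopyBallSlice
import Literature.Topology.FourManifolds.ZeroSurgeryHomotopyBallSliceProofs
import Literature.Barriers.SmoothPoincare4.GluckTwistsDissolve
import Literature.Topology.FourManifolds.Rasmussen
import Literature.Topology.FourManifolds.SliceGenus

/-!
# Sketch — crux-ideate `stmt-SmoothPoincare4-0364` (`ZeroSurgeryExotic.ZseThesis`), round 1, ideator 1

First lemmas of the two idea cards, stated over existing declarations (they elaborate; the
provable ones are proved, the others are `Prop` statements).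

* Card `bph-blind-spot-witness`: `zseThesis_of_obstruction` (shape of the line: ANY `B⁴` slice
  obstruction `r` works as witness), `IsDissolveBlind` + `exists_not_dissolvesInCP2_of_blind_witness`
  (THE PRICE LEMMA FOR PAIRS: a witness certified by a dissolve-blind `r` forces a homotopy 4-sphere
  that does not dissolve in `ℂℙ²`, i.e. an exotic `ℂℙ²`-sum), `isDissolveBlind_rasmussen` (`s` is
  dissolve-blind, given MMSW §9.3).  Contrapositive = the lever: a price-free witness needs `r` NOT
  dissolve-blind.
* Card `annulus-orbit-stabilisation`: `zseThesis_of_orbit` (an orbit of 0-friends of one slice seed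
  with ONE obstructed member proves the thesis) and `RasmussenBoundedOnOrbit` (statement: `s` takes
  only finitely many values on a 0-surgery class — `|s| ≤ 2·genus`, Gabai + Rasmussen).
-/

noncomputable section

open scoped Manifold ContDiff
open ContinuousMap Literature.Topology.FourManifolds Literature.Barriers.SmoothPoincare4
open Summit.SmoothPoincare4.SmoothPoincare4.Theses.ZeroSurgeryExotic

set_option linter.dupNamespace false

namespace Summit.SmoothPoincare4.SmoothPoincare4.Cruxes.ZseThesis.Ideator1

/-- Local notation: `𝔼 n` is `EuclideanSpace ℝ (Fin n)`. -/
local notation "𝔼 " n:arg => EuclideanSpace ℝ (Fin n)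

/-- Local notation: the standard `4`-sphere. -/
local notation "𝕊⁴" => (Metric.sphere (0 : EuclideanSpace ℝ (Fin 5)) 1)

/-! ## Card 1 — `bph-blind-spot-witness` -/

/-- **Shape of the line.** Any knot predicate `r` that fails on smoothly slice knots (a `B⁴`
slice OBSTRUCTION — e.g. "the LEO class is nontrivial", "`s^{Sq²}_± ≠ 0`") turns a 0-surgery pair
`(K slice, r K')` into the thesis. (Trivial glue; the line instantiates `r` by a refined
Khovanov obstruction, to be vendored as a named fact.) -/
theorem zseThesis_of_obstruction (r : Knot → Prop)
    (hr : ∀ K : Knot, K.IsSmoothlySlice → ¬ r K)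
    (h : ∃ (K K' : Knot) (Y : Type) (_ : TopologicalSpace Y) (_ : ChartedSpace (𝔼 3) Y),
      IsIntegralSurgery (𝓡 3) Y K 0 ∧ IsIntegralSurgery (𝓡 3) Y K' 0 ∧ K.IsSmoothlySlice ∧ r K') :
    ZseThesis := by
  obtain ⟨K, K', Y, _, _, h1, h2, h3, h4⟩ := h
  exact ⟨K, K', Y, _, _, h1, h2, h3, fun hs => hr K' hs h4⟩

/-- **Dissolve-blind knot predicates**: `r` fails on every knot bounding a smooth proper disc off a
ball in a closed smooth homotopy 4-sphere `X` that `DissolvesInCP2` (every connected sum of `X`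
with `ℂℙ²`, either orientation, is `≅ ℂℙ²`).  By MMSW 2023 §9.3 the predicate "`s ≠ 0`" is
dissolve-blind (`isDissolveBlind_rasmussen`); by Nakamura 2023 (remark after Thm 3.13) so is every
invariant obeying an adjunction inequality in `#n ℂℙ²`. -/
def IsDissolveBlind (r : Knot → Prop) : Prop :=
  ∀ (X : Type) [TopologicalSpace X] [T2Space X] [SecondCountableTopology X] [ChartedSpace (𝔼 4) X]
    [IsManifold (𝓡 4) ∞ X] [CompactSpace X], Nonempty (X ≃ₕ 𝕊⁴) → DissolvesInCP2 X →
    ∀ (K : Knot) (e : 𝔼 4 → X) (f : 𝔼 2 → X), K.IsSliceDiscIn X e f → ¬ r K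

/-- **The price lemma for 0-surgery pairs.** GIVEN Manolescu–Piccirillo Lemma 3.3 for `W = S⁴`
(a named fact of the tree, discharged in `ZeroSurgeryHomotopyBallSliceHolds.lean`): if a 0-surgery
pair `(K, K')` with `K` smoothly slice has `K'` certified by a DISSOLVE-BLIND obstruction `r`, then
the Manolescu–Piccirillo sphere carrying the `K'`-disc does NOT dissolve: some closed smooth
connected sum of it with `ℂℙ²` admits no diffeomorphism to `ℂℙ²` (an exotic `ℂℙ²` up to
orientation, by Freedman).  Contrapositive (the lever of the card): a proof of `ZseThesis` that does
not also produce an exotic `ℂℙ²` must certify `K'` by an obstruction that is NOT dissolve-blind —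
one that is nonzero on some knot slice in a dissolving homotopy sphere, in particular on some
biprojectively H-slice knot. -/
theorem exists_not_dissolvesInCP2_of_blind_witness
    (hMP : Knot.ManolescuPiccirillo2023_lemma33_sphere)
    {r : Knot → Prop} (hblind : IsDissolveBlind r)
    (h : ∃ (K K' : Knot) (Y : Type) (_ : TopologicalSpace Y) (_ : ChartedSpace (𝔼 3) Y),
      IsIntegralSurgery (𝓡 3) Y K 0 ∧ IsIntegralSurgery (𝓡 3) Y K' 0 ∧ K.IsSmoothlySlice ∧ r K') :
    ∃ (X : Type) (_ : TopologicalSpace X) (_ : T2Space X) (_ : SecondCountableTopology X)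
      (_ : ChartedSpace (𝔼 4) X) (_ : IsManifold (𝓡 4) ∞ X) (_ : CompactSpace X),
      Nonempty (X ≃ₕ 𝕊⁴) ∧
      (∃ (K' : Knot) (e : 𝔼 4 → X) (f : 𝔼 2 → X), K'.IsSliceDiscIn X e f ∧ r K') ∧
      ∃ (P : Type) (_ : TopologicalSpace P) (_ : T2Space P) (_ : SecondCountableTopology P)
        (_ : ChartedSpace (𝔼 4) P) (_ : IsManifold (𝓡 4) ∞ P) (_ : CompactSpace P),
        IsConnectedSum (𝓡 4) (𝓡 4) (𝓡 4) X ComplexProjectivePlane P ∧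
          IsEmpty (P ≃ₘ⟮𝓡 4, 𝓡 4⟯ ComplexProjectivePlane) := by
  obtain ⟨K, K', Y, _, _, h1, h2, h3, h4⟩ := h
  have hK' : K'.IsHomotopyBallSlice :=
    hMP K K' Y ((FramedLink.isSurgery_single_iff K 0).2 h1)
      ((FramedLink.isSurgery_single_iff K' 0).2 h2) h3
  obtain ⟨X, _, _, _, _, _, _, hX, e, f, hKX⟩ := hK'
  refine ⟨X, ‹_›, ‹_›, ‹_›, ‹_›, ‹_›, ‹_›, hX, ⟨K', e, f, hKX, h4⟩, ?_⟩
  by_contra hne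
  refine hblind X hX ?_ K' e f hKX h4
  intro P _ _ _ _ _ _ hP
  by_contra hP'
  exact hne ⟨P, ‹_›, ‹_›, ‹_›, ‹_›, ‹_›, ‹_›, hP, not_nonempty_iff.1 hP'⟩

/-- `s ≠ 0` is dissolve-blind, GIVEN MMSW 2023 §9.3 (`mmsw2023_sZero_of_dissolvesInCP2`, the
catalogue's named fact). So the plain-`s` sub-crux `ZseCruxRasmussen` always pays the price; the
card's witnesses must come from OUTSIDE this class. -/
theorem isDissolveBlind_rasmussen (hM : mmsw2023_sZero_of_dissolvesInCP2) :
    IsDissolveBlind (fun K => ∃ s : ℤ, K.HasRasmussenInvariant s ∧ s ≠ 0) := by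
  intro X _ _ _ _ _ _ hX hd K e f hK ⟨s, hs, hs0⟩
  exact hs0 (hM X hX hd K e f hK s hs)

/-- **Target lemma L0 of the card (statement only; the cheapest falsifier decides it).** "There is
a knot predicate that is a `B⁴` slice obstruction but NOT dissolve-blind."  The card bets this holds
for the LEO class / the `Sq²`-refined `s`; a theorem "refined invariants satisfy the
`ℂℙ²`-adjunction inequality" (refined Lee structure of `T(2p,2p)` = unrefined) would refute the bet
for that invariant. -/
def ExistsNonBlindObstruction : Prop :=
  ∃ r : Knot → Prop, (∀ K : Knot, K.IsSmoothlySlice → ¬ r K) ∧ ¬ IsDissolveBlind r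

/-! ## Card 2 — `annulus-orbit-stabilisation` -/

/-- **Orbit form of the thesis.** An (annulus-twist) orbit `J : ℤ → Knot` of 0-friends of the
slice seed `J 0` — all sharing ONE 0-surgery `Y` — proves the thesis as soon as one member carries
a `B⁴` slice obstruction. (Glue; the content of the card is that for annulus-twist orbits the
sequence `n ↦ (refined) s(J n)` should be decided by finitely many members.) -/
theorem zseThesis_of_orbit (r : Knot → Prop) (hr : ∀ K : Knot, K.IsSmoothlySlice → ¬ r K)
    (J : ℤ → Knot) (Y : Type) [TopologicalSpace Y] [ChartedSpace (𝔼 3) Y]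
    (hY : ∀ n, IsIntegralSurgery (𝓡 3) Y (J n) 0) (h0 : (J 0).IsSmoothlySlice)
    (hn : ∃ n, r (J n)) : ZseThesis := by
  obtain ⟨n, hn⟩ := hn
  exact zseThesis_of_obstruction r hr ⟨J 0, J n, Y, _, _, hY 0, hY n, h0, hn⟩

/-- **`s` is bounded on a 0-surgery class (statement).** If `J 0` has a Seifert surface of genus
`g` and the 0-friends `J n` share its Seifert genus bound (Gabai 1987 Cor 8.3: 0-surgery detects
genus — hypothesis `hgen`), then every `J n` has `|s| ≤ 2g` (Seifert surfaces push into `B⁴`,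
`HasSeifertSurfaceOfGenus.hasSliceSurfaceOfGenus`; Rasmussen's `|s| ≤ 2 g₄`,
`abs_le_two_mul_sliceGenus`). So along any infinite orbit `s` takes finitely many values; the card
conjectures EVENTUAL PERIODICITY in the twist parameter (MMSW 2023 Thm 1.1-type stabilisation). -/
def RasmussenBoundedOnOrbit : Prop :=
  ∀ (J : ℤ → Knot) (g : ℕ), (J 0).HasSeifertSurfaceOfGenus g →
    (∀ n, ∃ g', g' ≤ g ∧ (J n).HasSeifertSurfaceOfGenus g') →
    ∀ (n : ℤ) (s : ℤ), (J n).HasRasmussenInvariant s → |s| ≤ 2 * (g : ℤ)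

end Summit.SmoothPoincare4.SmoothPoincare4.Cruxes.ZseThesis.Ideator1

end
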